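import Literature.NumberTheory.GaloisRepresentations.UnramifiedKummer
import HarnessLib

/-!
# The inertia orbit of an element of fractional valuation has at least `d` elements
# (Serre 1972, §1.3; Serre, *Local Fields*, Ch. I §6)

`Proofs` file (theorems only: no definition, no named fact), trunk GalRep, sequel of
`UnramifiedKummer`.  Let `F` be a non-archimedean local field, `‖·‖ = algNorm F` the absolute
value of `F̄ = AlgebraicClosure F`, `I_F = absInertia F` its inertia group, `F_nr = maxUnramified F`
(`= F(μ_{p'})`, whose non-zero elements have norm in `‖ϖ‖^ℤ`,
`exists_algNorm_eq_zpow_of_mem_maxUnramified`) and `ϖ` a uniformiser of `𝒪[F]`.  The file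
`UnramifiedKummer` proves that for a ROOT `z` of `z ^ d = ϖ` the powers `1, z, …, z^{d-1}` are
`F_nr`-independent and deduces the surjectivity of the Kummer character `θ_d : I_F → μ_d`.  The
independence uses only the NORM of `z`; here we record this and its consequence for orbits:

* `linearIndependent_pow_of_algNorm_pow_eq` — if **`‖z‖ ^ d = ‖ϖ‖`** (`d ≥ 1`) then
  `1, z, …, z^{d-1}` are `F_nr`-linearly independent (the non-zero terms `m_i z^i` of a relation
  have pairwise distinct norms `‖ϖ‖^{n_i + i/d}`);
* `le_natDegree_minpoly_maxUnramified_of_algNorm_pow_eq` — hence `[F_nr(z) : F_nr] ≥ d`;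
* `exists_absInertia_smul_injective_of_algNorm_pow_eq` — hence (in characteristic `0`) **`z` has
  at least `d` distinct conjugates under the inertia group**: there are `σ₀, …, σ_{d-1} ∈ I_F`
  with `σ_i z` pairwise distinct (the `≥ d` distinct roots of the separable polynomial
  `minpoly_{F_nr}(z)` in `F̄` are `Aut(F̄/F_nr) = I_F`-conjugates of `z`, Mathlib
  `minpoly.exists_algEquiv_of_root'`, `mem_absInertia_iff_forall_mem_maxUnramified`);
* `exists_absInertia_smul_injective_of_algNorm_pow_mul_eq_one` — the same for `z` with
  `‖z‖ ^ d · ‖ϖ‖ = 1` (apply the previous statement to `z⁻¹`).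

This is the elementary half of "`e(F_nr(z)/F_nr) ≥ d` when `v(z) = 1/d`" (Serre, *Local Fields*,
Ch. I §6; Serre, Invent. Math. 15 (1972), §1.3: `K_d/K_nr` is totally ramified of degree `d`),
stated for the orbit so that it can be transported to a global inertia group
(`Literature/NumberTheory/EllipticCurves/PlaceOverInertiaOrbitProofs.lean`).  Use (cell `b2b-bsdres`,
team n1011, row T-b1ss): the abscissa of a `9`-torsion point above a non-zero `3`-torsion point at a
good supersingular `3` has valuation `-1/36`, hence `≥ 36` inertia conjugates — the counting step
of the `3`-adic tower at a supersingular `3` (Wuthrich 2014, Lemma 20).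

## References

* [SerreInventiones1972] J.-P. Serre, Invent. Math. 15 (1972) 259–331, §1.3.
* [SerreLocalFields1979] J.-P. Serre, *Local Fields*, GTM 67 (1979), Ch. I §6, Ch. IV §4.
* [NeukirchANT1999] J. Neukirch, *Algebraic Number Theory*, Ch. II (6.8), (7.5).
-/

noncomputable section

open ValuativeRel Field
open scoped Pointwise IntermediateField

namespace Literature.NumberTheory.GaloisRepresentations
namespace IsNonarchimedeanLocalField

variable {F : Type*} [Field F] [ValuativeRel F] [TopologicalSpace F] [IsNonarchimedeanLocalField F]

/-- **Independence of `1, z, …, z^{d-1}` over `F_nr` from the norm of `z` alone**: if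
`‖z‖ ^ d = ‖ϖ‖` for a uniformiser `ϖ` and `d ≥ 1`, the powers `z ^ i`, `i < d`, are
`F_nr`-linearly independent — the non-zero terms `m_i z ^ i` of a relation have pairwise distinct
norms `‖ϖ‖ ^ (n_i + i/d)` (`exists_algNorm_eq_zpow_of_mem_maxUnramified`,
`eq_zero_of_sum_eq_zero_of_algNorm_injOn`).  The proof of
`linearIndependent_pow_of_pow_eq_uniformizer` verbatim, with its only use of `z ^ d = ϖ` — the
norm identity — turned into the hypothesis.
[cite: SerreInventiones1972, §1.3] [cite: SerreLocalFields1979, Ch. I §6] -/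
theorem linearIndependent_pow_of_algNorm_pow_eq {d : ℕ} (hd : 0 < d) {ϖ : 𝒪[F]}
    (hϖ : Irreducible ϖ) {z : AlgebraicClosure F}
    (hzd : algNorm F z ^ d = algNorm F (algebraMap 𝒪[F] (AlgebraicClosure F) ϖ))
    (m : Fin d → maxUnramified F) (hm : ∑ i, ((m i : AlgebraicClosure F)) * z ^ (i : ℕ) = 0) :
    ∀ i, m i = 0 := by
  have hc0 := algNorm_uniformizer_pos hϖ
  have hc1 := algNorm_uniformizer_lt_one hϖ
  have hz0 : z ≠ 0 := by
    intro h
    rw [h, algNorm_zero, zero_pow hd.ne'] at hzd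
    exact hc0.ne hzd
  have key := eq_zero_of_sum_eq_zero_of_algNorm_injOn Finset.univ
    (fun i : Fin d => ((m i : AlgebraicClosure F)) * z ^ (i : ℕ)) ?_ hm
  · intro i
    have := key i (Finset.mem_univ i)
    rcases mul_eq_zero.mp this with h | h
    · exact_mod_cast h
    · exact absurd h (pow_ne_zero _ hz0)
  -- distinct norms
  intro i _ j _ hi hj heq
  have hmi : (m i : AlgebraicClosure F) ≠ 0 := fun h => hi (by simp [h])
  have hmj : (m j : AlgebraicClosure F) ≠ 0 := fun h => hj (by simp [h])
  obtain ⟨a, ha⟩ := exists_algNorm_eq_zpow_of_mem_maxUnramified hϖ (m i).2 hmi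
  obtain ⟨b, hb⟩ := exists_algNorm_eq_zpow_of_mem_maxUnramified hϖ (m j).2 hmj
  -- take `d`-th powers: `c ^ (a d + i) = c ^ (b d + j)`
  set c := algNorm F (algebraMap 𝒪[F] (AlgebraicClosure F) ϖ) with hcdef
  have hzi : ∀ k : ℕ, (algNorm F z ^ k) ^ d = c ^ k := fun k => by
    rw [← pow_mul, mul_comm, pow_mul, hzd]
  have hpow : c ^ (a * d + (i : ℕ) : ℤ) = c ^ (b * d + (j : ℕ) : ℤ) := by
    have h := congrArg (fun r => r ^ d) heq
    simp only [algNorm_mul, algNorm_pow, mul_pow, ha, hb, hzi] at h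
    rw [zpow_add₀ hc0.ne', zpow_add₀ hc0.ne', zpow_mul, zpow_mul, zpow_natCast, zpow_natCast,
      zpow_natCast, zpow_natCast]
    exact h
  rw [zpow_right_inj₀ hc0 hc1.ne] at hpow
  -- `a d + i = b d + j` with `i, j < d`
  apply Fin.ext
  have h1 : ((a * d + i : ℤ) % d) = ((b * d + j : ℤ) % d) := by rw [hpow]
  rw [Int.add_comm, Int.add_mul_emod_self_right, Int.add_comm, Int.add_mul_emod_self_right] at h1
  have hi' : ((i : ℕ) : ℤ) % d = i := Int.emod_eq_of_lt (by positivity) (by exact_mod_cast i.2)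
  have hj' : ((j : ℕ) : ℤ) % d = j := Int.emod_eq_of_lt (by positivity) (by exact_mod_cast j.2)
  rw [hi', hj'] at h1
  exact_mod_cast h1

/-- **`[F_nr(z) : F_nr] ≥ d` when `‖z‖ ^ d = ‖ϖ‖`**: the minimal polynomial of `z` over
`F_nr = maxUnramified F` has degree at least `d` (otherwise it would be a non-trivial
`F_nr`-relation among `1, z, …, z^{d-1}`).  The ramification index of `F_nr(z)/F_nr` is a multiple
of `d`; Serre, *Local Fields*, Ch. I §6. [cite: SerreLocalFields1979, Ch. I §6]
[cite: SerreInventiones1972, §1.3] -/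
theorem le_natDegree_minpoly_maxUnramified_of_algNorm_pow_eq {d : ℕ} (hd : 0 < d) {ϖ : 𝒪[F]}
    (hϖ : Irreducible ϖ) {z : AlgebraicClosure F}
    (hzd : algNorm F z ^ d = algNorm F (algebraMap 𝒪[F] (AlgebraicClosure F) ϖ)) :
    d ≤ (minpoly (maxUnramified F) z).natDegree := by
  set M := maxUnramified F
  have hzi : IsIntegral M z :=
    ((Algebra.IsAlgebraic.isAlgebraic (R := F) z).isIntegral).tower_top
  have hpm : (minpoly M z).Monic := minpoly.monic hzi
  by_contra hlt
  push Not at hlt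
  have hsum := minpoly.aeval M z
  rw [Polynomial.aeval_eq_sum_range' hlt, Finset.sum_range] at hsum
  simp only [Algebra.smul_def] at hsum
  have h0 := linearIndependent_pow_of_algNorm_pow_eq hd hϖ hzd (fun i => (minpoly M z).coeff i)
    (by simpa using hsum)
  -- the leading coefficient is `1 ≠ 0`
  have hlead := h0 ⟨(minpoly M z).natDegree, hlt⟩
  simp only [Polynomial.coeff_natDegree, hpm.leadingCoeff] at hlead
  exact one_ne_zero hlead

/-- **At least `d` inertia conjugates.**  Let `F` have characteristic `0`, `ϖ` a uniformiser,
`d ≥ 1`, and `z ∈ F̄` with `‖z‖ ^ d = ‖ϖ‖`.  Then there are `σ₀, …, σ_{d-1}` in the inertia group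
`I_F` such that the conjugates `σ_i z` are pairwise distinct.  (The minimal polynomial of `z` over
`F_nr` is separable of degree `≥ d`, so it has `≥ d` distinct roots in `F̄`; each is `σ z` for some
`σ ∈ Aut(F̄/F_nr)` by Mathlib's `minpoly.exists_algEquiv_of_root'`, and `Aut(F̄/F_nr) = I_F`,
`mem_absInertia_iff_forall_mem_maxUnramified`.)  Serre, Invent. Math. 15 (1972), §1.3 (for
`z = ϖ^{1/d}` this is the surjectivity of `θ_d`; `exists_mem_absInertia_smul_eq_mul`).
[cite: SerreInventiones1972, §1.3] [cite: SerreLocalFields1979, Ch. I §6] -/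
theorem exists_absInertia_smul_injective_of_algNorm_pow_eq [CharZero F] {d : ℕ} (hd : 0 < d)
    {ϖ : 𝒪[F]} (hϖ : Irreducible ϖ) {z : AlgebraicClosure F}
    (hzd : algNorm F z ^ d = algNorm F (algebraMap 𝒪[F] (AlgebraicClosure F) ϖ)) :
    ∃ σ : Fin d → absoluteGaloisGroup F,
      (∀ i, σ i ∈ absInertia F) ∧ Function.Injective fun i ↦ σ i • z := by
  classical
  set M := maxUnramified F
  haveI : Normal M (AlgebraicClosure F) := Normal.tower_top_of_normal F M (AlgebraicClosure F)
  have halgF : IsAlgebraic F z := Algebra.IsAlgebraic.isAlgebraic z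
  have hzi : IsIntegral M z := (halgF.isIntegral).tower_top
  have halg : IsAlgebraic M z := hzi.isAlgebraic
  -- the minimal polynomial over `M`: separable, of degree `≥ d`, split in `F̄`
  set q := minpoly M z
  have hdeg : d ≤ q.natDegree := le_natDegree_minpoly_maxUnramified_of_algNorm_pow_eq hd hϖ hzd
  haveI : CharZero (AlgebraicClosure F) :=
    charZero_of_injective_algebraMap (algebraMap F (AlgebraicClosure F)).injective
  haveI : CharZero M := charZero_of_injective_algebraMap (algebraMap F M).injective
  have hsep : q.Separable := (minpoly.irreducible hzi).separable
  set Q := q.map (algebraMap M (AlgebraicClosure F)) with hQ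
  have hQsplit : Q.Splits := IsAlgClosed.splits Q
  have hQsep : Q.Separable := hsep.map
  have hQdeg : Q.natDegree = q.natDegree := Polynomial.natDegree_map _
  have hcard : Q.roots.toFinset.card = q.natDegree := by
    rw [Multiset.toFinset_card_of_nodup (Polynomial.nodup_roots hQsep),
      ← hQsplit.natDegree_eq_card_roots, hQdeg]
  -- `d` distinct roots
  have hdle : Fintype.card (Fin d) ≤ Fintype.card Q.roots.toFinset := by
    rw [Fintype.card_fin, Fintype.card_coe, hcard]; exact hdeg
  obtain ⟨e⟩ := Function.Embedding.nonempty_iff_card_le.mpr hdle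
  -- each root is an `Aut(F̄/M)`-conjugate of `z`
  have hconj : ∀ i : Fin d, ∃ σ : absoluteGaloisGroup F, σ ∈ absInertia F ∧
      σ • z = (e i : AlgebraicClosure F) := by
    intro i
    have hmem : ((e i : Q.roots.toFinset) : AlgebraicClosure F) ∈ Q.roots :=
      Multiset.mem_toFinset.mp (e i).2
    have hroot : Polynomial.aeval ((e i : Q.roots.toFinset) : AlgebraicClosure F) q = 0 := by
      have h : Polynomial.eval ((e i : Q.roots.toFinset) : AlgebraicClosure F)
          (q.map (algebraMap M (AlgebraicClosure F))) = 0 := Polynomial.isRoot_of_mem_roots hmem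
      rwa [Polynomial.eval_map, ← Polynomial.aeval_def] at h
    obtain ⟨σ, hσ⟩ := minpoly.exists_algEquiv_of_root' halg hroot
    refine ⟨(absoluteGaloisGroup.toAlgEquiv F).symm (σ.restrictScalars F), ?_, ?_⟩
    · rw [mem_absInertia_iff_forall_mem_maxUnramified]
      intro x hx
      rw [absoluteGaloisGroup.smul_def, MulEquiv.apply_symm_apply, AlgEquiv.restrictScalars_apply]
      exact σ.commutes (⟨x, hx⟩ : M)
    · rw [absoluteGaloisGroup.smul_def, MulEquiv.apply_symm_apply, AlgEquiv.restrictScalars_apply]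
      exact hσ
  choose σ hσI hσz using hconj
  refine ⟨σ, hσI, fun i j hij ↦ ?_⟩
  have : (e i : AlgebraicClosure F) = e j := by
    have h := hij
    simp only [hσz] at h
    exact h
  exact e.injective (Subtype.ext this)

/-- **At least `d` inertia conjugates, for `‖z‖ ^ d · ‖ϖ‖ = 1`** (i.e. `z` of valuation `-1/d`):
apply `exists_absInertia_smul_injective_of_algNorm_pow_eq` to `z⁻¹` (`σ z⁻¹ = (σ z)⁻¹`).
[cite: SerreInventiones1972, §1.3] [cite: SerreLocalFields1979, Ch. I §6] -/
theorem exists_absInertia_smul_injective_of_algNorm_pow_mul_eq_one [CharZero F] {d : ℕ}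
    (hd : 0 < d) {ϖ : 𝒪[F]} (hϖ : Irreducible ϖ) {z : AlgebraicClosure F}
    (hzd : algNorm F z ^ d * algNorm F (algebraMap 𝒪[F] (AlgebraicClosure F) ϖ) = 1) :
    ∃ σ : Fin d → absoluteGaloisGroup F,
      (∀ i, σ i ∈ absInertia F) ∧ Function.Injective fun i ↦ σ i • z := by
  have hzd' : algNorm F z⁻¹ ^ d = algNorm F (algebraMap 𝒪[F] (AlgebraicClosure F) ϖ) := by
    rw [algNorm_inv, inv_pow]
    exact inv_eq_of_mul_eq_one_right hzd
  obtain ⟨σ, hσI, hinj⟩ := exists_absInertia_smul_injective_of_algNorm_pow_eq hd hϖ hzd'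
  refine ⟨σ, hσI, fun i j hij ↦ hinj ?_⟩
  have h : σ i • z = σ j • z := hij
  change σ i • z⁻¹ = σ j • z⁻¹
  rw [smul_inv'', smul_inv'', h]

end IsNonarchimedeanLocalField
end Literature.NumberTheory.GaloisRepresentations

end
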